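import Mathlib
import HarnessLib
import Summits.Ventures.LatticeQCDFlow.Scoring.BatchMeansMartingaleCLT

/-!
# Window averages from ANY start under a geometric envelope, uniformly in the window's position:
# `E_{μ₀}|(1/N) Σ_{t<N} g(X_{s+t}) − πg| ≤ K_g/√N` and `E_{μ₀}|(1/N) Σ_{t<N} D²_{s+t} − πq| ≤ K_h/√N`

HONEST FRAMING: exact (Metropolis-corrected) sampling algorithms for lattice gauge theory;
figures of merit are autocorrelation/cost numbers at stated couplings and volumes; no
continuum-physics claim.

Venture `LatticeQCDFlow` (cell pub-lqcd), topic `Scoring`; FANOUT row 4 (`s0-u1-b`, GEN-32).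
NEW WORK of the cell, not a published result; no definition is introduced; nothing is cited as a
fact.  Two `L¹` laws of large numbers with explicit `1/√N` rates, from ANY initial law and UNIFORM
in the position `s` of the window, for a Markov kernel `κ` with a geometric sup-norm envelope
`(A, ρ)` (`|κ^t g − πg| ≤ 2C_g A ρ^t`): (i) the window average of a bounded observable `g`
(`chain_windowAverage_abs_sub_le_of_envelope`; the case `s = 0` is
`Scoring/ChainSampleVarianceRate.chain_timeAverage_abs_sub_le_of_envelope`, same proof via the
any-start block second moment `Scoring/GeometricEnvelopeBlockSumMoments.chain_blockSum_sq_le_of_envelope`);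
(ii) the window average of the SQUARED MARTINGALE INCREMENTS `D_u = h(X_{u+1}) − κh(X_u)` of a
bounded `h`, which converges to `πq`, `q = κ(h²) − (κh)²` the conditional variance: the differences
`D²_u − q(X_u)` are bounded by `4C_h²` and orthogonal
(`Scoring/ChainMartingaleIncrements.chain_increment_sq` + Pythagoras
`Scoring/BatchMeansMartingaleCLT.integral_sq_sum_eq_of_orthogonal`), so their average is
`≤ 4C_h²/√N` in `L²`, and (i) handles the average of `q`.  These are the quadratic-variation inputs
of the fixed-number-of-batches central limit theorems (`Scoring/WeightedBlockSumCLT.lean`,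
`Scoring/BatchMeansJointCLT.lean`), where the windows are the batches `[b_n j, b_n j + b_n)`.
A Markov-inequality helper turning an `L¹` rate into convergence in measure is included.

## Content (envelope `(A, ρ)`, `0 ≤ A`, `0 ≤ ρ < 1`; `P_{μ₀}` the path law from ANY `μ₀`)

* `tendstoInMeasure_const_of_integral_abs_le` — `E|X_n − c| ≤ ε_n → 0` ⇒ `X_n → c` in measure;
* **`chain_windowAverage_abs_sub_le_of_envelope`** — `|g| ≤ C_g` measurable, `N ≠ 0`, any `s`:
  `E_{μ₀}|(1/N) Σ_{t<N} g(X_{s+t}) − πg| ≤ √10 · (4 C_g A/(1−ρ))/√N`;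
* **`chain_condVarAverage_abs_sub_le_of_envelope`** — `|h| ≤ C_h` measurable, `N ≠ 0`, any `s`:
  `E_{μ₀}|(1/N) Σ_{t<N} D²_{s+t} − πq| ≤ (4C_h² + √10 · 4C_h²A/(1−ρ))/√N`.

NOT CLAIMED: sharper constants; unbounded observables; anything about a concrete sampler.
-/

noncomputable section

namespace Summit.Ventures.LatticeQCDFlow.Scoring

open MeasureTheory ProbabilityTheory Filter Finset Preorder
open scoped ENNReal Topology RealInnerProductSpace

variable {Ω : Type*} [MeasurableSpace Ω]

/-! ### An `L¹` bound gives convergence in measure -/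

/-- **Markov**: if `E|X_n − c| ≤ ε_n` eventually with `ε_n → 0` (and the `X_n` are measurable and
bounded), then `X_n → c` in measure. -/
theorem tendstoInMeasure_const_of_integral_abs_le {Ω₀ : Type*} [MeasurableSpace Ω₀]
    (μ : Measure Ω₀) [IsProbabilityMeasure μ] {X : ℕ → Ω₀ → ℝ} (hXm : ∀ n, Measurable (X n))
    {K : ℕ → ℝ} (hXb : ∀ n ω, |X n ω| ≤ K n) {c : ℝ} {ε : ℕ → ℝ}
    (hle : ∀ᶠ n in atTop, ∫ ω, |X n ω - c| ∂μ ≤ ε n) (hε : Tendsto ε atTop (𝓝 0)) :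
    TendstoInMeasure μ X atTop (fun _ => c) := by
  rw [tendstoInMeasure_iff_measureReal_norm]
  intro δ hδ
  refine squeeze_zero' (Eventually.of_forall fun n => measureReal_nonneg) ?_ (by simpa using hε.div_const δ)
  filter_upwards [hle] with n hn
  have hiD : Integrable (fun ω => |X n ω - c|) μ :=
    integrable_of_bounded μ ((hXm n).sub measurable_const).abs (C := K n + |c|) fun ω => by
      rw [abs_abs]; exact (abs_sub _ _).trans (by linarith [hXb n ω])
  have hset : {ω | δ ≤ ‖X n ω - c‖} = {ω | δ ≤ |X n ω - c|} := by
    ext ω; simp only [Set.mem_setOf_eq, Real.norm_eq_abs]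
  rw [hset]
  have hcheb := mul_meas_ge_le_integral_of_nonneg (μ := μ) (ae_of_all _ fun ω => abs_nonneg (X n ω - c))
    hiD δ
  calc μ.real {ω | δ ≤ |X n ω - c|} ≤ (∫ ω, |X n ω - c| ∂μ) / δ := by
        rw [le_div_iff₀ hδ, mul_comm]; exact hcheb
    _ ≤ ε n / δ := div_le_div_of_nonneg_right hn hδ.le

section Envelope

variable {κ : Kernel Ω Ω} [IsMarkovKernel κ] {π : Measure Ω} [IsProbabilityMeasure π] {A ρ : ℝ}

/-! ### Window averages from any start -/

/-- **Window averages are `√N`-consistent in `L¹` from any start, uniformly in the window's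
position**: envelope `(A, ρ)` (`0 ≤ A`, `0 ≤ ρ < 1`), `|g| ≤ C_g` measurable, `N ≠ 0`, any `s`:
`E_{μ₀}|(1/N) Σ_{t<N} g(X_{s+t}) − π g| ≤ √10 · (4 C_g A/(1−ρ)) / √N`.  (The case `s = 0` is
`Scoring/ChainSampleVarianceRate.chain_timeAverage_abs_sub_le_of_envelope`.) -/
theorem chain_windowAverage_abs_sub_le_of_envelope
    (henv : ∀ (g : Ω → ℝ), Measurable g → ∀ (Cg : ℝ), (∀ x, |g x| ≤ Cg) →
      ∀ (t : ℕ) (x : Ω), |(kop κ)^[t] g x - ∫ y, g y ∂π| ≤ 2 * Cg * (A * ρ ^ t))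
    (hA : 0 ≤ A) (hρ0 : 0 ≤ ρ) (hρ1 : ρ < 1)
    {g : Ω → ℝ} (hg : Measurable g) {Cg : ℝ} (hCg : ∀ x, |g x| ≤ Cg)
    (μ₀ : Measure Ω) [IsProbabilityMeasure μ₀] (s : ℕ) {N : ℕ} (hN : N ≠ 0)
    [IsProbabilityMeasure (Kernel.trajMeasure (X := fun _ : ℕ => Ω) (μ₀)
          (fun n : ℕ => κ.comap (fun h' : (i : ↥(Finset.Iic n)) → Ω => h' ⟨n, Finset.mem_Iic.2 le_rfl⟩)
            (measurable_pi_apply _)))] :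
    ∫ x, |(∑ t ∈ Finset.range N, g (x (s + t))) / (N : ℝ) - ∫ z, g z ∂π| ∂(Kernel.trajMeasure (X := fun _ : ℕ => Ω) (μ₀)
          (fun n : ℕ => κ.comap (fun h' : (i : ↥(Finset.Iic n)) → Ω => h' ⟨n, Finset.mem_Iic.2 le_rfl⟩)
            (measurable_pi_apply _)))
      ≤ Real.sqrt 10 * (4 * Cg * A / (1 - ρ)) / Real.sqrt N := by
  set P := (Kernel.trajMeasure (X := fun _ : ℕ => Ω) (μ₀)
        (fun n : ℕ => κ.comap (fun h' : (i : ↥(Finset.Iic n)) → Ω => h' ⟨n, Finset.mem_Iic.2 le_rfl⟩)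
          (measurable_pi_apply _))) with hP
  obtain ⟨x0⟩ := nonempty_of_isProbabilityMeasure μ₀
  have hCg0 : 0 ≤ Cg := (abs_nonneg _).trans (hCg x0)
  have hK0 : 0 ≤ 4 * Cg * A / (1 - ρ) := div_nonneg (by positivity) (by linarith)
  have hNR : (0 : ℝ) < N := by exact_mod_cast Nat.pos_of_ne_zero hN
  obtain ⟨hgbm, hgb, -⟩ := centred_observable_bounds π hg hCg
  have h2 := chain_blockSum_sq_le_of_envelope (κ := κ) henv hρ0 hρ1 hg hCg μ₀ s (n := N) hN
  rw [← hP] at h2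
  set K := 4 * Cg * A / (1 - ρ) with hK
  clear_value K
  have hre : ∀ x : ℕ → Ω, (∑ t ∈ Finset.range N, (g (x (s + t)) - ∫ z, g z ∂π)) / (N : ℝ)
      = (∑ t ∈ Finset.range N, g (x (s + t))) / (N : ℝ) - ∫ z, g z ∂π := fun x => by
    rw [Finset.sum_sub_distrib, sub_div, Finset.sum_const, Finset.card_range, nsmul_eq_mul,
      mul_div_cancel_left₀ _ hNR.ne']
  simp_rw [← hre]
  have hm : Measurable fun x : ℕ → Ω =>
      (∑ t ∈ Finset.range N, (g (x (s + t)) - ∫ z, g z ∂π)) / (N : ℝ) :=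
    (Finset.measurable_sum _ fun t _ => hgbm.comp (measurable_pi_apply _)).div_const _
  have hbd : ∀ x : ℕ → Ω, |(∑ t ∈ Finset.range N, (g (x (s + t)) - ∫ z, g z ∂π)) / (N : ℝ)|
      ≤ N * (2 * Cg) / N := fun x => by
    rw [abs_div, abs_of_pos hNR]
    refine div_le_div_of_nonneg_right ((Finset.abs_sum_le_sum_abs _ _).trans ?_) hNR.le
    calc ∑ t ∈ Finset.range N, |g (x (s + t)) - ∫ z, g z ∂π|
        ≤ ∑ _t ∈ Finset.range N, 2 * Cg := Finset.sum_le_sum fun t _ => hgb _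
      _ = N * (2 * Cg) := by rw [Finset.sum_const, Finset.card_range, nsmul_eq_mul]
  have h1 := sq_integral_le_integral_sq P hm.abs (C := N * (2 * Cg) / N)
    (fun x => by rw [abs_abs]; exact hbd x)
  simp only [sq_abs] at h1
  have hJ : ∫ x, |(∑ t ∈ Finset.range N, (g (x (s + t)) - ∫ z, g z ∂π)) / (N : ℝ)| ∂P
      ≤ Real.sqrt (∫ x, ((∑ t ∈ Finset.range N, (g (x (s + t)) - ∫ z, g z ∂π)) / (N : ℝ)) ^ 2 ∂P) :=
    (Real.le_sqrt (integral_nonneg fun x => abs_nonneg _)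
      (integral_nonneg fun x => sq_nonneg _)).2 h1
  have h3 : ∫ x, ((∑ t ∈ Finset.range N, (g (x (s + t)) - ∫ z, g z ∂π)) / (N : ℝ)) ^ 2 ∂P
      ≤ 10 * K ^ 2 / N := by
    simp_rw [div_pow]
    rw [integral_div, div_le_div_iff₀ (by positivity) hNR]
    have := mul_le_mul_of_nonneg_right h2 hNR.le
    nlinarith [this]
  refine hJ.trans ((Real.sqrt_le_sqrt h3).trans (le_of_eq ?_))
  rw [Real.sqrt_div (by positivity), Real.sqrt_mul (by norm_num), Real.sqrt_sq hK0]

/-! ### The running average of the squared martingale increments -/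

/-- **`E_{μ₀}|(1/N) Σ_{t<N} D²_{s+t} − πq| ≤ (4C_h² + √10 · 4C_h²A/(1−ρ))/√N`**, uniformly in the
window start `s` and the initial law: `D_u = h(X_{u+1}) − κh(X_u)`, `q = κ(h²) − (κh)²`, `|h| ≤ C_h`
measurable, envelope `(A, ρ)`.  The differences `D²_u − q(X_u)` are bounded by `4C_h²` and orthogonal
(`Scoring/ChainMartingaleIncrements.chain_increment_sq`), so their average is `≤ 4C_h²/√N` in `L²`;
the window average of `q` is handled by `chain_windowAverage_abs_sub_le_of_envelope`. -/
theorem chain_condVarAverage_abs_sub_le_of_envelope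
    (henv : ∀ (g : Ω → ℝ), Measurable g → ∀ (Cg : ℝ), (∀ x, |g x| ≤ Cg) →
      ∀ (t : ℕ) (x : Ω), |(kop κ)^[t] g x - ∫ y, g y ∂π| ≤ 2 * Cg * (A * ρ ^ t))
    (hA : 0 ≤ A) (hρ0 : 0 ≤ ρ) (hρ1 : ρ < 1)
    {h : Ω → ℝ} (hh : Measurable h) {Ch : ℝ} (hCh : ∀ x, |h x| ≤ Ch)
    (μ₀ : Measure Ω) [IsProbabilityMeasure μ₀] (s : ℕ) {N : ℕ} (hN : N ≠ 0)
    [IsProbabilityMeasure (Kernel.trajMeasure (X := fun _ : ℕ => Ω) (μ₀)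
          (fun n : ℕ => κ.comap (fun h' : (i : ↥(Finset.Iic n)) → Ω => h' ⟨n, Finset.mem_Iic.2 le_rfl⟩)
            (measurable_pi_apply _)))] :
    ∫ x, |(∑ t ∈ Finset.range N, (h (x (s + t + 1)) - kop κ h (x (s + t))) ^ 2) / (N : ℝ)
        - ∫ z, (kop κ (fun y => h y ^ 2) z - (kop κ h z) ^ 2) ∂π| ∂(Kernel.trajMeasure (X := fun _ : ℕ => Ω) (μ₀)
          (fun n : ℕ => κ.comap (fun h' : (i : ↥(Finset.Iic n)) → Ω => h' ⟨n, Finset.mem_Iic.2 le_rfl⟩)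
            (measurable_pi_apply _)))
      ≤ (4 * Ch ^ 2 + Real.sqrt 10 * (4 * Ch ^ 2 * A / (1 - ρ))) / Real.sqrt N := by
  set P := (Kernel.trajMeasure (X := fun _ : ℕ => Ω) (μ₀)
        (fun n : ℕ => κ.comap (fun h' : (i : ↥(Finset.Iic n)) → Ω => h' ⟨n, Finset.mem_Iic.2 le_rfl⟩)
          (measurable_pi_apply _))) with hP
  obtain ⟨x0⟩ := nonempty_of_isProbabilityMeasure μ₀
  have hC0 : 0 ≤ Ch := (abs_nonneg _).trans (hCh x0)
  have hNR : (0 : ℝ) < N := by exact_mod_cast Nat.pos_of_ne_zero hN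
  have hsN : 0 < Real.sqrt N := Real.sqrt_pos.2 hNR
  obtain ⟨hqm, hqb⟩ := kopCondVar_bounded_measurable κ hh hCh
  set q : Ω → ℝ := fun z => kop κ (fun y => h y ^ 2) z - (kop κ h z) ^ 2 with hq
  -- the orthogonal differences `e_t = D²_{s+t} − q(X_{s+t})`
  set e : ℕ → (ℕ → Ω) → ℝ := fun t x => (h (x (s + t + 1)) - kop κ h (x (s + t))) ^ 2 - q (x (s + t))
    with he
  have hDm : ∀ u, Measurable fun x : ℕ → Ω => h (x (u + 1)) - kop κ h (x u) := fun u =>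
    (hh.comp (measurable_pi_apply _)).sub ((measurable_kop κ hh).comp (measurable_pi_apply _))
  have hDb : ∀ u (x : ℕ → Ω), |h (x (u + 1)) - kop κ h (x u)| ≤ 2 * Ch := fun u x =>
    (abs_sub _ _).trans (by linarith [hCh (x (u + 1)), abs_kop_le κ hCh (x u)])
  have hem : ∀ t, Measurable (e t) := fun t =>
    ((hDm (s + t)).pow_const 2).sub (hqm.comp (measurable_pi_apply _))
  have heb : ∀ t x, |e t x| ≤ 4 * Ch ^ 2 := by
    intro t x
    have h1 : (h (x (s + t + 1)) - kop κ h (x (s + t))) ^ 2 ≤ (2 * Ch) ^ 2 := by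
      have := hDb (s + t) x
      rw [← sq_abs]; exact pow_le_pow_left₀ (abs_nonneg _) this 2
    have h2 := kopCondVar_nonneg κ hh hCh (x (s + t))
    have h3 := kopCondVar_le κ hCh (x (s + t))
    simp only [he, hq]
    rw [abs_le]; constructor <;> nlinarith [sq_nonneg (h (x (s + t + 1)) - kop κ h (x (s + t)))]
  have horth : ∀ t₁ t₂, t₁ < t₂ → ∫ x, e t₁ x * e t₂ x ∂P = 0 := by
    intro t₁ t₂ hlt
    have hGd : DependsOn (e t₁) (Set.Iic (s + t₂)) := by
      intro x y hxy
      simp only [he, hq]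
      rw [hxy (s + t₁ + 1) (Set.mem_Iic.2 (by omega)), hxy (s + t₁) (Set.mem_Iic.2 (by omega))]
    have key := chain_increment_sq κ μ₀ (s + t₂) (hem t₁) hGd (heb t₁) hh hCh
    rw [← hP] at key
    have hi1 : Integrable (fun x : ℕ → Ω => e t₁ x * (h (x (s + t₂ + 1)) - kop κ h (x (s + t₂))) ^ 2) P :=
      integrable_of_bounded P ((hem t₁).mul ((hDm (s + t₂)).pow_const 2)) (C := 4 * Ch ^ 2 * (2 * Ch) ^ 2)
        fun x => by
          rw [abs_mul, abs_pow]
          exact mul_le_mul (heb t₁ x) (pow_le_pow_left₀ (abs_nonneg _) (hDb _ x) 2) (by positivity)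
            (by positivity)
    have hi2 : Integrable (fun x : ℕ → Ω => e t₁ x * q (x (s + t₂))) P :=
      integrable_of_bounded P ((hem t₁).mul (hqm.comp (measurable_pi_apply _))) (C := 4 * Ch ^ 2 * Ch ^ 2)
        fun x => by rw [abs_mul]; exact mul_le_mul (heb t₁ x) (hqb _) (abs_nonneg _) (by positivity)
    have hsplit : ∀ x : ℕ → Ω, e t₁ x * e t₂ x
        = e t₁ x * (h (x (s + t₂ + 1)) - kop κ h (x (s + t₂))) ^ 2 - e t₁ x * q (x (s + t₂)) := fun x => by
      simp only [he]; ring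
    simp_rw [hsplit]
    rw [integral_sub hi1 hi2, key, sub_self]
  -- `L²` size of the average of the differences
  have hPyth := integral_sq_sum_eq_of_orthogonal P hem heb horth N
  have hE2 : ∫ x, ((∑ t ∈ Finset.range N, e t x) / (N : ℝ)) ^ 2 ∂P ≤ (4 * Ch ^ 2) ^ 2 / N := by
    simp_rw [div_pow]
    rw [integral_div, hPyth, div_le_div_iff₀ (by positivity) hNR]
    have hterm : ∀ t ∈ Finset.range N, ∫ x, e t x ^ 2 ∂P ≤ (4 * Ch ^ 2) ^ 2 := fun t _ => by
      calc ∫ x, e t x ^ 2 ∂P ≤ ∫ x, (4 * Ch ^ 2) ^ 2 ∂P :=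
            integral_mono_of_nonneg (ae_of_all _ fun x => sq_nonneg _) (integrable_const _)
              (ae_of_all _ fun x => by
                have := abs_le.1 (heb t x)
                exact sq_le_sq' this.1 this.2)
        _ = (4 * Ch ^ 2) ^ 2 := by rw [integral_const, probReal_univ, one_smul]
    calc (∑ t ∈ Finset.range N, ∫ x, e t x ^ 2 ∂P) * N ≤ (∑ _t ∈ Finset.range N, (4 * Ch ^ 2) ^ 2) * N :=
          mul_le_mul_of_nonneg_right (Finset.sum_le_sum hterm) hNR.le
      _ = (4 * Ch ^ 2) ^ 2 * (N : ℝ) ^ 2 := by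
          rw [Finset.sum_const, Finset.card_range, nsmul_eq_mul]; ring
  have hSm : Measurable fun x : ℕ → Ω => (∑ t ∈ Finset.range N, e t x) / (N : ℝ) :=
    (Finset.measurable_sum _ fun t _ => hem t).div_const _
  have hSb : ∀ x : ℕ → Ω, |(∑ t ∈ Finset.range N, e t x) / (N : ℝ)| ≤ N * (4 * Ch ^ 2) / N := fun x => by
    rw [abs_div, abs_of_pos hNR]
    refine div_le_div_of_nonneg_right ((Finset.abs_sum_le_sum_abs _ _).trans ?_) hNR.le
    calc ∑ t ∈ Finset.range N, |e t x| ≤ ∑ _t ∈ Finset.range N, 4 * Ch ^ 2 :=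
          Finset.sum_le_sum fun t _ => heb t x
      _ = N * (4 * Ch ^ 2) := by rw [Finset.sum_const, Finset.card_range, nsmul_eq_mul]
  have hJ1 := sq_integral_le_integral_sq P hSm.abs (C := N * (4 * Ch ^ 2) / N)
    (fun x => by rw [abs_abs]; exact hSb x)
  simp only [sq_abs] at hJ1
  have hE1 : ∫ x, |(∑ t ∈ Finset.range N, e t x) / (N : ℝ)| ∂P ≤ 4 * Ch ^ 2 / Real.sqrt N := by
    have h1 : ∫ x, |(∑ t ∈ Finset.range N, e t x) / (N : ℝ)| ∂P
        ≤ Real.sqrt (∫ x, ((∑ t ∈ Finset.range N, e t x) / (N : ℝ)) ^ 2 ∂P) :=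
      (Real.le_sqrt (integral_nonneg fun x => abs_nonneg _)
        (integral_nonneg fun x => sq_nonneg _)).2 hJ1
    refine h1.trans ((Real.sqrt_le_sqrt hE2).trans (le_of_eq ?_))
    rw [Real.sqrt_div (by positivity), Real.sqrt_sq (by positivity)]
  -- the window average of `q`
  have hCq : ∀ z, |q z| ≤ Ch ^ 2 := hqb
  have hE3 := chain_windowAverage_abs_sub_le_of_envelope henv hA hρ0 hρ1 hqm hCq μ₀ s hN
  rw [← hP] at hE3
  -- assemble
  have hdecomp : ∀ x : ℕ → Ω,
      (∑ t ∈ Finset.range N, (h (x (s + t + 1)) - kop κ h (x (s + t))) ^ 2) / (N : ℝ) - ∫ z, q z ∂π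
        = (∑ t ∈ Finset.range N, e t x) / (N : ℝ)
          + ((∑ t ∈ Finset.range N, q (x (s + t))) / (N : ℝ) - ∫ z, q z ∂π) := fun x => by
    simp only [he]
    rw [Finset.sum_sub_distrib, sub_div]
    ring
  have hi1 : Integrable (fun x : ℕ → Ω => |(∑ t ∈ Finset.range N, e t x) / (N : ℝ)|) P :=
    integrable_of_bounded P hSm.abs (C := N * (4 * Ch ^ 2) / N) fun x => by rw [abs_abs]; exact hSb x
  have hWm : Measurable fun x : ℕ → Ω => (∑ t ∈ Finset.range N, q (x (s + t))) / (N : ℝ) - ∫ z, q z ∂π :=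
    ((Finset.measurable_sum _ fun t _ => hqm.comp (measurable_pi_apply _)).div_const _).sub
      measurable_const
  have hWb : ∀ x : ℕ → Ω, |(∑ t ∈ Finset.range N, q (x (s + t))) / (N : ℝ) - ∫ z, q z ∂π|
      ≤ N * Ch ^ 2 / N + Ch ^ 2 := fun x => by
    refine (abs_sub _ _).trans (add_le_add ?_ ?_)
    · rw [abs_div, abs_of_pos hNR]
      refine div_le_div_of_nonneg_right ((Finset.abs_sum_le_sum_abs _ _).trans ?_) hNR.le
      calc ∑ t ∈ Finset.range N, |q (x (s + t))| ≤ ∑ _t ∈ Finset.range N, Ch ^ 2 :=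
            Finset.sum_le_sum fun t _ => hCq _
        _ = N * Ch ^ 2 := by rw [Finset.sum_const, Finset.card_range, nsmul_eq_mul]
    · calc |∫ z, q z ∂π| = ‖∫ z, q z ∂π‖ := (Real.norm_eq_abs _).symm
        _ ≤ Ch ^ 2 * π.real Set.univ := norm_integral_le_of_norm_le_const
            (Eventually.of_forall fun z => by rw [Real.norm_eq_abs]; exact hCq z)
        _ = Ch ^ 2 := by rw [probReal_univ, mul_one]
  have hi2 : Integrable (fun x : ℕ → Ω => |(∑ t ∈ Finset.range N, q (x (s + t))) / (N : ℝ) - ∫ z, q z ∂π|) P :=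
    integrable_of_bounded P hWm.abs (C := N * Ch ^ 2 / N + Ch ^ 2) fun x => by rw [abs_abs]; exact hWb x
  calc ∫ x, |(∑ t ∈ Finset.range N, (h (x (s + t + 1)) - kop κ h (x (s + t))) ^ 2) / (N : ℝ) - ∫ z, q z ∂π| ∂P
      = ∫ x, |(∑ t ∈ Finset.range N, e t x) / (N : ℝ)
          + ((∑ t ∈ Finset.range N, q (x (s + t))) / (N : ℝ) - ∫ z, q z ∂π)| ∂P := by
        simp_rw [hdecomp]
    _ ≤ ∫ x, |(∑ t ∈ Finset.range N, e t x) / (N : ℝ)|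
          + |(∑ t ∈ Finset.range N, q (x (s + t))) / (N : ℝ) - ∫ z, q z ∂π| ∂P :=
        integral_mono_of_nonneg (ae_of_all _ fun x => abs_nonneg _) (hi1.add hi2)
          (ae_of_all _ fun x => abs_add_le _ _)
    _ = ∫ x, |(∑ t ∈ Finset.range N, e t x) / (N : ℝ)| ∂P
          + ∫ x, |(∑ t ∈ Finset.range N, q (x (s + t))) / (N : ℝ) - ∫ z, q z ∂π| ∂P :=
        integral_add hi1 hi2
    _ ≤ 4 * Ch ^ 2 / Real.sqrt N + Real.sqrt 10 * (4 * Ch ^ 2 * A / (1 - ρ)) / Real.sqrt N :=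
        add_le_add hE1 hE3
    _ = (4 * Ch ^ 2 + Real.sqrt 10 * (4 * Ch ^ 2 * A / (1 - ρ))) / Real.sqrt N := by ring

end Envelope

end Summit.Ventures.LatticeQCDFlow.Scoring

end
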